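import Literature.InformationTheory.QuantumCodes.AbelianTwoBlockParameters
import Literature.InformationTheory.Coding.GilbertVarshamovDual
import HarnessLib

/-!
# Wang–Pryadko 2022 §3.5: a two-block code with EQUAL blocks is empty or has distance two

[WangPryadko2022, §3.5] (arXiv:2203.17216 chunk p0009 L105–109): "A non-trivial GB code of weight `w = 4`
can only be constructed when both `a(x)` and `b(x)` have equal weights. Moreover, weight-two polynomials of
equal degrees, or a polynomial of degree `ℓ/2` with `ℓ` even, always give an empty code or a distance-two
code." The first alternative ("weight-two polynomials of equal degrees", i.e. `a = b` after the
equivalences of their Statement 4) is an instance of the following fact, proved here for the tree's binary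
abelian two-block codes `AbelianTwoBlock.css a b` over ANY finite abelian group and ANY `a` (any weight):
for `a = b` the diagonal vectors `(e_g; e_g)` are `Z`-codewords of weight `2`; either one of them is not a
`Z`-stabilizer (then `d_Z ≤ 2`, and `d_X = d_Z`), or all of them are, in which case `A = circ(a)` is
surjective, hence injective, and `k = 2·dim ker A = 0` — **`css_self_k_eq_zero_or_dZ_le_two`**. (The
second alternative, `a = 1 + x^{ℓ/2}`, is specific to cyclic groups and weight two and is not treated here.)

## References

* [WangPryadko2022] R. Wang, L. P. Pryadko, *Distance bounds for generalized bicycle codes*, Symmetry 14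
  (2022) 1348 = arXiv:2203.17216, §3.5 (held text chunk p0009 L105–109).
-/

namespace Literature.InformationTheory.QuantumCodes

namespace AbelianTwoBlock

open Matrix
open Literature.InformationTheory.Coding (hammingNorm_sumElim)

variable {G : Type*} [Fintype G] [AddCommGroup G] [DecidableEq G]

/-- For `a = b` the diagonal vector `(e_g; e_g)` is a `Z`-codeword: `[A|A](e_g;e_g) = Ae_g + Ae_g = 0` over
`𝔽₂`. [cite: WangPryadko2022, §3.5 "weight-two polynomials of equal degrees … always give an empty code or a distance-two code" (arXiv:2203.17216 chunk p0009 L105–109)] -/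
theorem HX_self_mulVec_diag (a : G → ZMod 2) (g : G) :
    (css a a).HX *ᵥ Sum.elim (Pi.single g 1) (Pi.single g 1) = 0 := by
  rw [css_HX, HX_def, Matrix.fromCols_mulVec_sumElim]
  have h2 : ∀ x : ZMod 2, x + x = 0 := by decide
  funext i
  exact h2 _

/-- `(e_g; e_g)` is a `Z`-stabilizer of `css a a` iff `e_g` is in the range of `A = circ(a)`.
[cite: WangPryadko2022, §3.5 (arXiv:2203.17216 chunk p0009 L105–109)] -/
theorem diag_mem_rowSpZ_iff (a : G → ZMod 2) (g : G) :
    Sum.elim (Pi.single g 1) (Pi.single g 1) ∈ (css a a).rowSpZ ↔ ∃ t, circulant a *ᵥ t = Pi.single g 1 := by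
  change Sum.elim (Pi.single g 1) (Pi.single g 1) ∈ rowSpace (css a a).HZ ↔ _
  rw [mem_rowSpace_iff, css_HZ, HZ_def]
  constructor
  · rintro ⟨t, ht⟩
    rw [Matrix.vecMul_fromCols, Matrix.vecMul_transpose] at ht
    exact ⟨t, by simpa using congrArg (· ∘ Sum.inl) ht⟩
  · rintro ⟨t, ht⟩
    exact ⟨t, by rw [Matrix.vecMul_fromCols, Matrix.vecMul_transpose, ht]⟩

omit [AddCommGroup G] in
/-- `wt(e_g; e_g) = 2`. [folklore] -/
private theorem hammingNorm_diag (g : G) :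
    hammingNorm (Sum.elim (Pi.single g (1 : ZMod 2)) (Pi.single g (1 : ZMod 2))) = 2 := by
  classical
  have h1 : hammingNorm (Pi.single g (1 : ZMod 2) : G → ZMod 2) = 1 := by
    simp [hammingNorm, Pi.single_apply, Finset.filter_eq']
  rw [hammingNorm_sumElim, h1]

omit [AddCommGroup G] in
/-- If every basis vector is in the range of `A`, then `A` is surjective. [folklore] -/
private theorem surjective_of_forall_single (A : Matrix G G (ZMod 2))
    (hall : ∀ g : G, ∃ t, A *ᵥ t = Pi.single g 1) : Function.Surjective A.mulVecLin := by
  choose t ht using hall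
  intro w
  refine ⟨∑ g, w g • t g, ?_⟩
  simp only [map_sum, map_smul, Matrix.mulVecLin_apply, ht]
  calc ∑ g, w g • (Pi.single g (1 : ZMod 2) : G → ZMod 2) = ∑ g, Pi.single g (w g) := by
        refine Finset.sum_congr rfl fun g _ => ?_
        rw [← Pi.single_smul', smul_eq_mul, mul_one]
    _ = w := Finset.univ_sum_single w

/-- ★ **Wang–Pryadko 2022 §3.5 (equal blocks): `a = b ⟹` the abelian two-block code `LP[a,a]` is empty
(`k = 0`) or has `d_Z ≤ 2`** — any finite abelian group, any weight. [cite: WangPryadko2022, §3.5 "always give an empty code or a distance-two code" (arXiv:2203.17216 chunk p0009 L105–109)] -/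
theorem css_self_k_eq_zero_or_dZ_le_two (a : G → ZMod 2) : (css a a).k = 0 ∨ (css a a).dZ ≤ 2 := by
  by_cases hinj : Function.Injective (circulant a).mulVecLin
  · left
    rw [css_k_eq, inf_idem, LinearMap.ker_eq_bot.2 hinj, finrank_bot, mul_zero]
  · right
    have hsurj : ¬ Function.Surjective (circulant a).mulVecLin := by
      rwa [← LinearMap.injective_iff_surjective]
    obtain ⟨g, hg⟩ : ∃ g : G, ∀ t, circulant a *ᵥ t ≠ Pi.single g 1 := by
      by_contra hall
      push Not at hall
      exact hsurj (surjective_of_forall_single _ hall)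
    have hv' : Sum.elim (Pi.single g 1) (Pi.single g 1) ∉ (css a a).rowSpZ := fun h =>
      (by obtain ⟨t, ht⟩ := (diag_mem_rowSpZ_iff a g).1 h; exact hg t ht)
    have := (css a a).dZ_le_hammingNorm (HX_self_mulVec_diag a g) hv'
    rwa [hammingNorm_diag] at this

/-- … equivalently with `d_X` (`d_X = d_Z` for abelian two-block codes). [cite: WangPryadko2022, §3.5 (arXiv:2203.17216 chunk p0009 L105–109)] -/
theorem css_self_k_eq_zero_or_dX_dZ_le_two (a : G → ZMod 2) :
    (css a a).k = 0 ∨ ((css a a).dX ≤ 2 ∧ (css a a).dZ ≤ 2) := by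
  rcases css_self_k_eq_zero_or_dZ_le_two a with h | h
  · exact Or.inl h
  · exact Or.inr ⟨(css_dX_eq_dZ a a).le.trans h, h⟩

end AbelianTwoBlock

end Literature.InformationTheory.QuantumCodes
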